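import Summits.BirchSwinnertonDyer.BirchSwinnertonDyer.Theorems.ThetaPartnerAtTwoSignedControlAtTwoOfPoitouTateThree
import Summits.BirchSwinnertonDyer.BirchSwinnertonDyer.Theorems.ThetaPartnerAtTwoSignedControlAtTwoStubPoitouTateSelmerRat
import Summits.BirchSwinnertonDyer.BirchSwinnertonDyer.Theorems.ThetaPartnerAtTwoSignedControlAtTwoShaThreeBaseH3Units
import HarnessLib

/-!
# K4 `SignedControlAtTwo` from ONE generic fact: Poitou–Tate 4.10 (a) over `ℚ` (`poitouTate_sha_tateDual ℚ`)

Route `ThetaPartnerAtTwo` (TP2; crux shared with `ResidualThetaTransportAtTwo`), crux K4 `SignedControlAtTwo`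
(stmt-BirchSwinnertonDyer-20309), line `eulerchar` (skeleton v15).  Seat `prover-bsd-wall-tp2-p3-w3` (width 3/3, gen 9).
The three-fact doors of `…OfPoitouTateThree` (width seat w2 g6: K4 ⟸ {PT(b), PT(a), 4.10(c)₃} over `ℚ`) with two of the three
facts now THEOREMS of the tree: PT(b) `poitouTate_selmerStructure_duality ℚ` (`PoitouTateSelmerRat.stub_poitouTateSelmerRat`, p625615,
from cell bsd-schneider's `poitouTate_selmerStructure_duality_holds`) and 4.10(c)₃ `poitouTate_three_realPlaces_injective ℚ`
(`ShaThreeBrauer.poitouTate_three_realPlaces_injective_holds`, p628282: Tate's `H³(Γ_F, F̄ˣ) = 0` + (hBr) + the lead's dévissage).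

* `signedControl_body_of_poitouTate_sha` — both conjuncts of the crux body for every curve of the row from PT(a) alone;
* **`signedControlAtTwo_of_poitouTate_sha (hPTa : poitouTate_sha_tateDual ℚ) : …Theses.ThetaPartnerAtTwo.SignedControlAtTwo`**;
* `signedControlAtTwo_rtt_of_poitouTate_sha` — the `ResidualThetaTransportAtTwo` copy.

HONEST FRAMING: theorems only; CONDITIONAL on the displayed hypothesis `poitouTate_sha_tateDual ℚ` (Milne I Thm. 4.10 (a) over `ℚ`,
the one remaining stub `stub_poitouTateShaRat` of the line — not proved here); closes no item by itself; BSD is not proved by any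
of this.
-/

set_option autoImplicit false
-- the Theorems namespace of this sub repeats the summit name by design (D-0017 nested layout)
set_option linter.dupNamespace false

noncomputable section

open scoped Classical NumberField

open NumberField IsDedekindDomain Field WeierstrassCurve
open Literature.NumberTheory.EllipticCurves Literature.NumberTheory.GaloisRepresentations
open Literature.NumberTheory.GaloisCohomology

namespace Summit.BirchSwinnertonDyer.BirchSwinnertonDyer.Theorems.SignedEC

namespace Door

/-- **The body of K4 `SignedControlAtTwo` for every curve of the row from Poitou–Tate 4.10 (a) over `ℚ` ALONE**
(`signedControl_body_of_poitouTate_three` with PT(b) and 4.10(c)₃ discharged by the tree's theorems).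
[cite: MilneADT2006, Ch. I, Thm. 4.10] [cite: Kobayashi2003, Thm. 1.2] [cite: GreenbergLNM1716, Prop. 4.13] -/
theorem signedControl_body_of_poitouTate_sha (hPTa : poitouTate_sha_tateDual ℚ)
    (W : WeierstrassCurve ℚ) [W.IsElliptic] [W.IsGloballyMinimal]
    (hss : Rank1Residual.GoodSS W 2) (ha : W.frobeniusTrace 2 = 0) :
    (∀ (κ : ZpExtension ℚ 2) (γ : Field.absoluteGaloisGroup ℚ), κ.IsCyclotomic → κ.IsTopGenerator γ →
        ∀ D : Kobayashi2003.SignedSelmerDualData W κ γ 1, Module.Finite (IwasawaAlgebra 2) D.X) ∧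
      (∀ (κ : ZpExtension ℚ 2) (γ : Field.absoluteGaloisGroup ℚ), κ.IsCyclotomic → κ.IsTopGenerator γ →
        ∀ (D : Kobayashi2003.SignedSelmerDualData W κ γ 1) [Module.Finite (IwasawaAlgebra 2) D.X],
          Module.IsTorsion (IwasawaAlgebra 2) D.X → ∀ g : IwasawaAlgebra 2, D.charIdeal = Ideal.span {g} →
          Finite (W.selmerGroupPInfty 2) →
          ∃ u : ℤ_[2]ˣ, ((PowerSeries.constantCoeff g : ℤ_[2]) : ℚ_[2]) =
            ((u : ℤ_[2]) : ℚ_[2]) * ((2 : ℕ) : ℚ_[2]) ^ (padicValNat 2 W.tamagawaProduct) *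
              (Nat.card (W.selmerGroupPInfty 2) : ℚ_[2])) :=
  signedControl_body_of_poitouTate_three PoitouTateSelmerRat.stub_poitouTateSelmerRat hPTa
    (ShaThreeBrauer.poitouTate_three_realPlaces_injective_holds ℚ) W hss ha

/-- **K4 `SignedControlAtTwo` (route `ThetaPartnerAtTwo` copy) BY NAME from Poitou–Tate 4.10 (a) over `ℚ` ALONE.**
[cite: MilneADT2006, Ch. I, Thm. 4.10 (a)] [cite: Kobayashi2003, Thm. 1.2] -/
theorem signedControlAtTwo_of_poitouTate_sha (hPTa : poitouTate_sha_tateDual ℚ) :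
    Summit.BirchSwinnertonDyer.BirchSwinnertonDyer.Theses.ThetaPartnerAtTwo.SignedControlAtTwo :=
  signedControlAtTwo_of_poitouTate_three PoitouTateSelmerRat.stub_poitouTateSelmerRat hPTa
    (ShaThreeBrauer.poitouTate_three_realPlaces_injective_holds ℚ)

/-- **K4 `SignedControlAtTwo` (route `ResidualThetaTransportAtTwo` copy) BY NAME from Poitou–Tate 4.10 (a) over `ℚ` ALONE.**
[cite: MilneADT2006, Ch. I, Thm. 4.10 (a)] [cite: Kobayashi2003, Thm. 1.2] -/
theorem signedControlAtTwo_rtt_of_poitouTate_sha (hPTa : poitouTate_sha_tateDual ℚ) :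
    Summit.BirchSwinnertonDyer.BirchSwinnertonDyer.Theses.ResidualThetaTransportAtTwo.SignedControlAtTwo :=
  signedControlAtTwo_rtt_of_poitouTate_three PoitouTateSelmerRat.stub_poitouTateSelmerRat hPTa
    (ShaThreeBrauer.poitouTate_three_realPlaces_injective_holds ℚ)

end Door

end Summit.BirchSwinnertonDyer.BirchSwinnertonDyer.Theorems.SignedEC

end
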